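import Summits.QuantumFields.BalabanUV.T4Continuum.Support.NE3CombGauge
import Summits.QuantumFields.BalabanUV.T4Continuum.Support.NE3CovariantWeitzenbock
import Summits.QuantumFields.BalabanUV.T4Continuum.Support.NE3StraightAverageAdjoint
import HarnessLib

/-!
# T⁴ programme, node NE3 — route H♮ (ruling ρ-g22-2), row K4, file K4-c (1∕2): THE COVARIANT BLOCK DIVERGENCE THEOREM —
# the block sum of the tree-transported fine covariant divergence `covDiv W η` IS the coarse covariant divergence (w.r.t. the
# straight segments `bseg`) of the κ-last-comb FACE FLUXES of `η`, up to three loop functionals each of first order in `M²a`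

NE3 (node U1b), row NE3 OWNER `b2b-balaban-t4-ne3-p1` (gen 23), K4 holder; SHAPE K4 (journal l.17848) item **K4-c** «THE LANDAU
KILL AT W = the covariant block divergence theorem with face mismatches `R_z` and the interior comb-loop term `K_B`» + ρ-g22-2a A1;
INTENT ∕ CLAIM journal l.18427.  File 2 (`NE3CovariantLandauKill`) pairs this with leaf-03-g7's face jump `JmpW` (K4-b) and the
coarse summation by parts.

WHAT.  Fix a block side `M ≥ 1`, a block `B(z)` with corner `q = M•z`, a units-valued fine configuration `W` and a fine 1-form `η`
(right-trivialised: `η (y, μ)` lives at `y + e_μ`).  The fine covariant divergence `covDiv W η y = Σ_μ (Ad_{W(y,μ)} η(y,μ) − η(y−e_μ,μ))`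
(`NE3CovariantWeitzenbock.covDiv`, the adjoint of `gaugeDir W`, `NE3LandauOrbit`) is transported to the corner along the block tree
(`btree M W z y = W(Γ_{q,y})`, C0's comb) and summed over the block.  Using `btree(y)·W(y,μ) = W₀(y,μ)·btree(y+e_μ)` (`W₀ =` the comb
gauge `gaugeAct (btree M W z) W`) and telescoping along every `μ`-line of the block, the sum equals
  `Σ_κ (farFlux z κ − farDefect z κ − nearFlux z κ) + combDefect z`                                                        **(A)**
where `farFlux z κ` is the flux OUT through the far `κ`-face with every bond value carried to the corner along the `κ`-LAST comb
(`treeWord t ++ seg κ M`, `t` transverse — the transport of K4-b's `cornerToBond` at the face bonds), `nearFlux z κ` the flux IN through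
the near `κ`-face read through the block tree, `combDefect z = Σ_{b based in B(z)} (Ad_{W₀(b)} − 1)(…)` THE INTERIOR COMB-LOOP
FUNCTIONAL `K_B` (A1), and `farDefect` the `κ`-LINE defects `(Ad_{W₀([q+t, q+t+Me_κ])} − 1)(…)` in the comb gauge.  The near flux of
`B(z)` is the far flux of `B(z − e_κ)` transported along the straight segment `bseg M W (z−e_κ) κ = W([q − Me_κ, q])`, up to the
Ad-defect of (a unitary conjugate of) BAŁABAN's (42) LOOP VARIABLE `Wcx M W (q − Me_κ) κ t`:
  `nearFlux z κ = Ad_{bseg(z−e_κ,κ)}⁻¹ (farFlux (z−e_κ) κ) + nearDefect z κ`                                                  **(B)**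
so that **(A+B)** the block sum is `NE3CovariantCalculus.cdiv (bseg-configuration) (farFlux W M η) z` minus `Σ_κ (farDefect + nearDefect)`
plus `combDefect` — the discrete divergence theorem at a curved background.  BOUNDS in the small-field class `‖W(∂p) − 1‖ ≤ a`
(C0 `norm_comb_sub_one_le_single`, `norm_hol_comb_seg_sub_one_le`, B8 `norm_Wcx_sub_one_le_omega` BY NAME):
`‖combDefect z‖ ≤ 2(d−1)(M−1)a·Σ_{v,μ}‖η(q+v) μ‖`, `‖farDefect z κ‖ ≤ 2(d−1)(M−1)M·a·Σ_t ‖η(far bond)‖`,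
`‖nearDefect z κ‖ ≤ 2(d−1)(M−1)M·a·Σ_t ‖η(near bond)‖` — every remainder carries `M²a` (`≤ b∕L²`) or `Ma` to the FIRST power
times the `ℓ¹` size (CONSTANT TARGET of SHAPE K4).  At `W = 1` all three vanish.

CONTENT (all [folklore]; 0 sorry; 0 `def … : Prop`; DATA defs `farFlux`, `nearFlux`, `combDefect`, `farDefect`, `nearDefect`):
§1 bookkeeping: `sum_periodBox_eq_sum_split` (the split chart `Equiv.funSplitAt κ`), **`sum_periodBox_telescope`**
   (`Σ_{v∈[0,M)^d} (F(v+e_κ) − F v) = Σ_t (F(t + Me_κ) − F t)` over transverse `t`), `btree_mul_eq`, `hol_tree_seg_eq`;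
§2 the five data defs and **(A) `sum_Ad_btree_covDiv_eq`**; §3 **(B) `nearFlux_eq`** and the `Wcx` form of the near defect;
§4 the three bounds; §5 periodicity of `farFlux` in the block index.

HONEST FRAMING.  Exact lattice bookkeeping at a GENERAL units-valued background plus three quoted loop bounds, on OUR typed objects;
nothing about Bałaban's minimisers; (P♮)_W, (ML_w) at W ≠ 1, T-E_w and NE3 are NOT proved; spine PROVED 0∕9; finite T⁴ rung (B)+1 —
NOT infinite volume, NOT mass gap, NOT BetaPertH, NOT Clay.  ABSOLUTE RULE kept (nothing printed is a hypothesis; context only: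
[Balaban1985Averaging] (8) p. 18, (42) p. 23, pp. 24–25, (122)–(125) p. 36).  PLACEMENT: `Summits/QuantumFields/BalabanUV/`; imports
accepted modules only (C0 `NE3CombGauge`, w4-W `NE3CovariantWeitzenbock`, (69S) `NE3StraightAverageAdjoint`).
-/

set_option autoImplicit false

open scoped BigOperators Matrix.Norms.L2Operator
open Finset

namespace Summit.QuantumFields.BalabanUV.T4Continuum.NE3CovariantBlockDivergence

open Literature.MathematicalPhysics.QuantumFieldTheory.Balaban1983to89
open B7Prop1Explicit B7Prop2Explicit
open B8Lemma1NonAbelian (lowPart norm_Wcx_sub_one_le_omega omegaC pairTop)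
open T4AveragingDeficitWall (IsUnitaryCfg SmallField Ad)
open T4AveragingDeficitWallBoundary (periodBox mem_periodBox IsPeriodicCfg)
open T4AveragingDeficitNonAbelian (Ad_mul Ad_sub hol_add_period)
open AveragingDeficitNearIdentity (Ad_one Ad_add Ad_sum norm_Ad_sub_le)
open AveragingDeficitTransport (norm_Ad_of_unitary mem_U1_of_unitary)
open AveragingDeficitBlockDensity (btree bseg btree_mem bseg_mem)
open NE3CombGauge (hol_comb hol_comb_corner isUnitaryCfg_comb norm_comb_sub_one_le_single norm_hol_comb_seg_sub_one_le
  l1_lowPart_le_single plaqSmall_of_smallField)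
open NE3CovariantWeitzenbock (covDiv)
open NE3CovariantCalculus (cdiv)
open NE3BlockLineAverage (sum_univ_boxVec)
open NE3StraightAverageAdjoint (tbase boxVec_funSplitAt_symm)

noncomputable section

variable {d : ℕ} {n : Type*} [Fintype n] [DecidableEq n]

/-! ## §1 Bookkeeping: the split chart, telescoping over a block, two transport identities -/

section Book

variable {A : Type*} [AddCommGroup A]

omit [Fintype n] [DecidableEq n] in
/-- Every block sum through the split chart at `κ`: `Σ_{v∈[0,M)^d} G v = Σ_t Σ_{a<M} G (t + a•e_κ)`, `t = tbase κ r'` transverse.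
[folklore] -/
theorem sum_periodBox_eq_sum_split (M : ℕ) (κ : Fin d) (G : Site d → A) :
    ∑ v ∈ periodBox (d := d) M, G v
      = ∑ r' : {j : Fin d // j ≠ κ} → Fin M, ∑ a : Fin M, G (tbase κ r' + ((a : ℕ) : ℤ) • e κ) := by
  set Φ := Equiv.funSplitAt κ (Fin M) with hΦ
  rw [← sum_univ_boxVec, Fintype.sum_equiv Φ (fun r => G (boxVec M r)) (fun p => G (boxVec M (Φ.symm p)))
    (fun r => by simp only [Equiv.symm_apply_apply]), Fintype.sum_prod_type, sum_comm]
  refine Fintype.sum_congr _ _ fun r' => Fintype.sum_congr _ _ fun a => ?_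
  rw [boxVec_funSplitAt_symm]

omit [Fintype n] [DecidableEq n] in
/-- **TELESCOPING OVER A BLOCK IN THE DIRECTION `κ`**: `Σ_{v∈[0,M)^d} (F(v + e_κ) − F v) = Σ_t (F(t + M•e_κ) − F t)` — only the
far and the near `κ`-faces survive. [folklore] -/
theorem sum_periodBox_telescope (M : ℕ) (κ : Fin d) (F : Site d → A) :
    ∑ v ∈ periodBox (d := d) M, (F (v + e κ) - F v)
      = ∑ r' : {j : Fin d // j ≠ κ} → Fin M, (F (tbase κ r' + (M : ℤ) • e κ) - F (tbase κ r')) := by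
  rw [sum_periodBox_eq_sum_split M κ]
  refine Fintype.sum_congr _ _ fun r' => ?_
  rw [Fin.sum_univ_eq_sum_range (fun a => F (tbase κ r' + ((a : ℕ) : ℤ) • e κ + e κ) - F (tbase κ r' + ((a : ℕ) : ℤ) • e κ)) M]
  have h := Finset.sum_range_sub (fun i => F (tbase κ r' + (i : ℤ) • e κ)) M
  have hre : ∀ i : ℕ, tbase κ r' + ((i : ℕ) : ℤ) • e κ + e κ = tbase κ r' + ((i + 1 : ℕ) : ℤ) • e κ := by
    intro i; push_cast; rw [add_smul, one_smul, add_assoc]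
  simp only [hre] at *
  rw [h]
  simp

/-- `btree(y) · W(y,μ) = W₀(y,μ) · btree(y + e_μ)`, `W₀ = gaugeAct (btree M W z) W` (definition of the gauge action). [folklore] -/
theorem btree_mul_eq (M : ℕ) (W : Site d → Fin d → (Matrix n n ℂ)ˣ) (z y : Site d) (μ : Fin d) :
    btree M W z y * W y μ = gaugeAct (btree M W z) W y μ * btree M W z (y + e μ) := by
  rw [gaugeAct, inv_mul_cancel_right]

/-- `btree M W z (q + t) = W(Γ_{q,q+t})`, `q = M•z`. [folklore] -/
theorem btree_corner_add (M : ℕ) (W : Site d → Fin d → (Matrix n n ℂ)ˣ) (z t : Site d) :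
    btree M W z ((M : ℤ) • z + t) = hol W ((M : ℤ) • z) (treeWord t) := by
  rw [btree, add_sub_cancel_left]

/-- **THE κ-LAST COMB TO THE FAR FACE FACTORS THROUGH THE COMB GAUGE**: `W(Γ_{q,q+t} ++ [q+t, q+t+Me_κ]) = W₀([q+t, q+t+Me_κ]) · btree(q + t + Me_κ)`.
[folklore] -/
theorem hol_tree_seg_eq (M : ℕ) (W : Site d → Fin d → (Matrix n n ℂ)ˣ) (z t : Site d) (κ : Fin d) :
    hol W ((M : ℤ) • z) (treeWord t ++ seg κ M)
      = hol (gaugeAct (btree M W z) W) ((M : ℤ) • z + t) (seg κ M) * btree M W z ((M : ℤ) • z + t + (M : ℤ) • e κ) := by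
  rw [hol_append, disp_treeWord, hol_comb, disp_seg, btree_corner_add]
  simp only [mul_assoc, inv_mul_cancel, mul_one]

end Book

/-! ## §2 The face fluxes, the loop functionals, and the block divergence identity (A) -/

/-- THE COVARIANT FLUX OUT OF `B(z)` THROUGH ITS FAR `κ`-FACE, read at the corner `q = M•z`: every face-crossing bond value
`η (q + t + (M−1)e_κ) κ` (living at `q + t + Me_κ`) is carried to `q` along the `κ`-LAST comb `Γ_{q,q+t} ++ [q+t, q+t+Me_κ]`
(= K4-b's `cornerToBond` at the face bonds). [folklore] -/
def farFlux (W : Site d → Fin d → (Matrix n n ℂ)ˣ) (M : ℕ) (η : Site d → Fin d → Matrix n n ℂ) (z : Site d) (κ : Fin d) :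
    Matrix n n ℂ :=
  ∑ r' : {j : Fin d // j ≠ κ} → Fin M,
    Ad (hol W ((M : ℤ) • z) (treeWord (tbase κ r') ++ seg κ M)) (η ((M : ℤ) • z + tbase κ r' + ((M : ℤ) - 1) • e κ) κ)

/-- THE COVARIANT FLUX INTO `B(z)` THROUGH ITS NEAR `κ`-FACE, read at the corner through the block tree: the bond values
`η (q + t − e_κ) κ` (living at the face sites `q + t`) carried by `btree M W z (q + t)`. [folklore] -/
def nearFlux (W : Site d → Fin d → (Matrix n n ℂ)ˣ) (M : ℕ) (η : Site d → Fin d → Matrix n n ℂ) (z : Site d) (κ : Fin d) :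
    Matrix n n ℂ :=
  ∑ r' : {j : Fin d // j ≠ κ} → Fin M, Ad (btree M W z ((M : ℤ) • z + tbase κ r')) (η ((M : ℤ) • z + tbase κ r' - e κ) κ)

/-- **THE INTERIOR COMB-LOOP FUNCTIONAL `K_B`** (ρ-g22-2a A1; D-ne3p1-g21-1 (C4a)): over all `d·M^d` bonds `b = (q+v, μ)` based in the
block, the Ad-defect of the comb-gauge bond variable `W₀(b) = W(Γ_{q,q+v} · b · Γ_{q,q+v+e_μ}⁻¹)` acting on the tree-transported bond
value. [folklore] -/
def combDefect (W : Site d → Fin d → (Matrix n n ℂ)ˣ) (M : ℕ) (η : Site d → Fin d → Matrix n n ℂ) (z : Site d) : Matrix n n ℂ :=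
  ∑ v ∈ periodBox (d := d) M, ∑ μ : Fin d,
    (Ad (gaugeAct (btree M W z) W ((M : ℤ) • z + v) μ) (Ad (btree M W z ((M : ℤ) • z + v + e μ)) (η ((M : ℤ) • z + v) μ))
      - Ad (btree M W z ((M : ℤ) • z + v + e μ)) (η ((M : ℤ) • z + v) μ))

/-- THE FAR-FACE DEFECT: the Ad-defect of the `κ`-LINES `W₀([q+t, q+t+Me_κ])` of the comb gauge acting on the tree-transported
face-crossing bond values. [folklore] -/
def farDefect (W : Site d → Fin d → (Matrix n n ℂ)ˣ) (M : ℕ) (η : Site d → Fin d → Matrix n n ℂ) (z : Site d) (κ : Fin d) :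
    Matrix n n ℂ :=
  ∑ r' : {j : Fin d // j ≠ κ} → Fin M,
    (Ad (hol (gaugeAct (btree M W z) W) ((M : ℤ) • z + tbase κ r') (seg κ M))
        (Ad (btree M W z ((M : ℤ) • z + tbase κ r' + (M : ℤ) • e κ)) (η ((M : ℤ) • z + tbase κ r' + ((M : ℤ) - 1) • e κ) κ))
      - Ad (btree M W z ((M : ℤ) • z + tbase κ r' + (M : ℤ) • e κ)) (η ((M : ℤ) • z + tbase κ r' + ((M : ℤ) - 1) • e κ) κ))

/-- THE NEAR-FACE DEFECT: the difference between reading the near-face bond values through the tree of `B(z)` and through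
«the κ-last comb of `B(z − e_κ)` followed by the straight segment `bseg M W (z−e_κ) κ`» — the Ad-defect of a unitary conjugate of
Bałaban's (42) loop variable `Wcx M W (q − Me_κ) κ t` (§3). [folklore] -/
def nearDefect (W : Site d → Fin d → (Matrix n n ℂ)ˣ) (M : ℕ) (η : Site d → Fin d → Matrix n n ℂ) (z : Site d) (κ : Fin d) :
    Matrix n n ℂ :=
  ∑ r' : {j : Fin d // j ≠ κ} → Fin M,
    (Ad (btree M W z ((M : ℤ) • z + tbase κ r')) (η ((M : ℤ) • z + tbase κ r' - e κ) κ)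
      - Ad ((bseg M W (z - e κ) κ)⁻¹ * hol W ((M : ℤ) • (z - e κ)) (treeWord (tbase κ r') ++ seg κ M))
          (η ((M : ℤ) • z + tbase κ r' - e κ) κ))

/-- **(A) THE BLOCK DIVERGENCE IDENTITY** (EXACT at every units-valued `W`, any `η`, any block side `M`):
`Σ_{v∈[0,M)^d} Ad_{btree(q+v)} (covDiv W η (q+v)) = Σ_κ (farFlux z κ − farDefect z κ − nearFlux z κ) + combDefect z`. [folklore] -/
theorem sum_Ad_btree_covDiv_eq (W : Site d → Fin d → (Matrix n n ℂ)ˣ) (M : ℕ) (η : Site d → Fin d → Matrix n n ℂ) (z : Site d) :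
    ∑ v ∈ periodBox (d := d) M, Ad (btree M W z ((M : ℤ) • z + v)) (covDiv W η ((M : ℤ) • z + v))
      = ∑ κ : Fin d, (farFlux W M η z κ - farDefect W M η z κ - nearFlux W M η z κ) + combDefect W M η z := by
  -- the tree-transported bond value, read from the END of the bond
  set X : Site d → Fin d → Matrix n n ℂ :=
    fun v μ => Ad (btree M W z ((M : ℤ) • z + v + e μ)) (η ((M : ℤ) • z + v) μ) with hX
  -- the μ-line functional that telescopes
  set F : Fin d → Site d → Matrix n n ℂ :=
    fun μ v => Ad (btree M W z ((M : ℤ) • z + v)) (η ((M : ℤ) • z + v - e μ) μ) with hF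
  have hFX : ∀ (v : Site d) (μ : Fin d), F μ (v + e μ) = X v μ := by
    intro v μ
    simp only [hF, hX, ← add_assoc, add_sub_cancel_right]
  -- pointwise: transported divergence = Σ_μ [(Ad W₀ − 1) X + (F(v+e_μ) − F v)]
  have hpt : ∀ v : Site d, Ad (btree M W z ((M : ℤ) • z + v)) (covDiv W η ((M : ℤ) • z + v))
      = ∑ μ : Fin d, ((Ad (gaugeAct (btree M W z) W ((M : ℤ) • z + v) μ) (X v μ) - X v μ) + (F μ (v + e μ) - F μ v)) := by
    intro v
    rw [covDiv, Ad_sum]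
    refine sum_congr rfl fun μ _ => ?_
    rw [Ad_sub, ← Ad_mul, btree_mul_eq, Ad_mul, hFX]
    simp only [hX, hF]
    abel
  rw [sum_congr rfl fun v _ => hpt v, sum_comm]
  -- now Σ_μ Σ_v (…): split into the comb defect and the telescoping part
  have hsplit : ∀ μ : Fin d, ∑ v ∈ periodBox (d := d) M,
      ((Ad (gaugeAct (btree M W z) W ((M : ℤ) • z + v) μ) (X v μ) - X v μ) + (F μ (v + e μ) - F μ v))
      = ∑ v ∈ periodBox (d := d) M, (Ad (gaugeAct (btree M W z) W ((M : ℤ) • z + v) μ) (X v μ) - X v μ)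
        + (farFlux W M η z μ - farDefect W M η z μ - nearFlux W M η z μ) := by
    intro μ
    rw [sum_add_distrib, sum_periodBox_telescope M μ (F μ)]
    congr 1
    rw [farFlux, farDefect, nearFlux, ← sum_sub_distrib, ← sum_sub_distrib]
    refine Fintype.sum_congr _ _ fun r' => ?_
    have h1 : (M : ℤ) • z + (tbase μ r' + (M : ℤ) • e μ) - e μ = (M : ℤ) • z + tbase μ r' + ((M : ℤ) - 1) • e μ := by
      rw [sub_smul, one_smul]; abel
    have h2 : (M : ℤ) • z + (tbase μ r' + (M : ℤ) • e μ) = (M : ℤ) • z + tbase μ r' + (M : ℤ) • e μ := by abel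
    simp only [hF]
    rw [h1, h2, hol_tree_seg_eq, Ad_mul]
    abel
  rw [sum_congr rfl fun μ _ => hsplit μ, sum_add_distrib, combDefect, sum_comm]
  abel

/-! ## §3 (B): the near flux is the transported far flux of the previous block, up to Bałaban's loop -/

/-- **(B) THE NEAR FLUX OF `B(z)` IS THE FAR FLUX OF `B(z − e_κ)` TRANSPORTED ALONG THE STRAIGHT SEGMENT, up to `nearDefect`**
(EXACT, every units-valued `W`). [folklore] -/
theorem nearFlux_eq (W : Site d → Fin d → (Matrix n n ℂ)ˣ) (M : ℕ) (η : Site d → Fin d → Matrix n n ℂ) (z : Site d) (κ : Fin d) :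
    nearFlux W M η z κ = Ad (bseg M W (z - e κ) κ)⁻¹ (farFlux W M η (z - e κ) κ) + nearDefect W M η z κ := by
  rw [farFlux, Ad_sum, nearFlux, nearDefect, ← sum_add_distrib]
  refine Fintype.sum_congr _ _ fun r' => ?_
  have h1 : (M : ℤ) • (z - e κ) + tbase κ r' + ((M : ℤ) - 1) • e κ = (M : ℤ) • z + tbase κ r' - e κ := by
    rw [smul_sub, sub_smul, one_smul]; abel
  rw [h1, ← Ad_mul]
  abel

/-- **THE NEAR DEFECT IS THE Ad-DEFECT OF A CONJUGATE OF BAŁABAN's (42) LOOP**: with `q′ = M•(z − e_κ)`, `S = bseg M W (z−e_κ) κ`,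
`B = btree M W z (q + t)`, `A = W(Γ_{q′,q′+t} ++ [q′+t, q′+t+Me_κ])`: `B⁻¹·S⁻¹·A = (S·B)⁻¹ · Wcx M W q′ κ t · (S·B)`, because
`Wcx = A · W(Γ_{q,q+t})⁻¹ · S⁻¹` (`hol_revWord`). [folklore] -/
theorem loop_conj_eq (M : ℕ) (W : Site d → Fin d → (Matrix n n ℂ)ˣ) (z t : Site d) (κ : Fin d) :
    (btree M W z ((M : ℤ) • z + t))⁻¹ * ((bseg M W (z - e κ) κ)⁻¹ * hol W ((M : ℤ) • (z - e κ)) (treeWord t ++ seg κ M))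
      = (bseg M W (z - e κ) κ * btree M W z ((M : ℤ) • z + t))⁻¹ * Wcx M W ((M : ℤ) • (z - e κ)) κ t
          * (bseg M W (z - e κ) κ * btree M W z ((M : ℤ) • z + t)) := by
  have hW : Wcx M W ((M : ℤ) • (z - e κ)) κ t
      = hol W ((M : ℤ) • (z - e κ)) (treeWord t ++ seg κ M) * (btree M W z ((M : ℤ) • z + t))⁻¹ * (bseg M W (z - e κ) κ)⁻¹ := by
    rw [Wcx, gammaWord, hol_append W _ (treeWord t ++ seg κ M), disp_append, disp_treeWord, disp_seg, btree_corner_add,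
      ← hol_revWord W ((M : ℤ) • z) (treeWord t), disp_treeWord, bseg, smul_sub]
    congr 2
    abel
  rw [hW]
  group

/-! ## §4 The three loop bounds in the small-field class -/

section Bounds

variable [Nonempty n] {M : ℕ} {W : Site d → Fin d → (Matrix n n ℂ)ˣ} (hW : IsUnitaryCfg W) {a : ℝ} (ha : 0 ≤ a)
  (hWa : SmallField W a)

omit [Nonempty n] in
/-- Transverse face offsets lie in the block: `0 ≤ tbase κ r' ≤ (M−1)·𝟙`. [folklore] -/
theorem tbase_nonneg (κ : Fin d) (r' : {j : Fin d // j ≠ κ} → Fin M) : (0 : Site d) ≤ tbase κ r' := by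
  intro j; simp only [tbase, Pi.zero_apply]; split_ifs <;> positivity

omit [Nonempty n] in
/-- Transverse face offsets lie in the block: `tbase κ r' ≤ (M−1)·𝟙` (for `M ≥ 1`). [folklore] -/
theorem tbase_le (hM : 1 ≤ M) (κ : Fin d) (r' : {j : Fin d // j ≠ κ} → Fin M) : tbase κ r' ≤ fun _ => (M : ℤ) - 1 := by
  intro j; simp only [tbase]
  split_ifs with h
  · have : (1 : ℤ) ≤ M := by exact_mod_cast hM
    linarith
  · have := (r' ⟨j, h⟩).isLt; omega

omit [Nonempty n] in
/-- Block offsets lie in the block. [folklore] -/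
theorem periodBox_nonneg_le {v : Site d} (hv : v ∈ periodBox (d := d) M) :
    (0 : Site d) ≤ v ∧ v ≤ fun _ => (M : ℤ) - 1 := by
  rw [mem_periodBox] at hv
  exact ⟨fun j => (hv j).1, fun j => by have := (hv j).2; simp only; omega⟩

include hW ha hWa

/-- **THE INTERIOR COMB-LOOP FUNCTIONAL IS FIRST ORDER IN `(d−1)(M−1)a`**:
`‖combDefect W M η z‖ ≤ 2(d−1)(M−1)a · Σ_{v∈[0,M)^d} Σ_μ ‖η (q+v) μ‖`. [folklore] -/
theorem norm_combDefect_le (η : Site d → Fin d → Matrix n n ℂ) (z : Site d) :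
    ‖combDefect W M η z‖
      ≤ 2 * (((d : ℝ) - 1) * ((M : ℝ) - 1) * a) * ∑ v ∈ periodBox (d := d) M, ∑ μ : Fin d, ‖η ((M : ℤ) • z + v) μ‖ := by
  rw [combDefect, mul_sum]
  refine (norm_sum_le _ _).trans (sum_le_sum fun v hv => ?_)
  rw [mul_sum]
  refine (norm_sum_le _ _).trans (sum_le_sum fun μ _ => ?_)
  obtain ⟨hv0, hv1⟩ := periodBox_nonneg_le hv
  have hx : (M : ℤ) • z ≤ (M : ℤ) • z + v := le_add_of_nonneg_right hv0
  have hx' : (M : ℤ) • z + v ≤ (M : ℤ) • z + fun _ => (M : ℤ) - 1 := add_le_add le_rfl hv1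
  have h := norm_comb_sub_one_le_single hW hWa ha z hx hx' μ
  calc _ ≤ 2 * ‖((gaugeAct (btree M W z) W ((M : ℤ) • z + v) μ : (Matrix n n ℂ)ˣ) : Matrix n n ℂ) - 1‖
        * ‖Ad (btree M W z ((M : ℤ) • z + v + e μ)) (η ((M : ℤ) • z + v) μ)‖ :=
        norm_Ad_sub_le (isUnitaryCfg_comb hW M z _ μ) _
    _ ≤ 2 * (((d : ℝ) - 1) * ((M : ℝ) - 1) * a) * ‖η ((M : ℤ) • z + v) μ‖ := by
        rw [norm_Ad_of_unitary (btree_mem hW M z _)]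
        gcongr

/-- **THE FAR-FACE DEFECT IS FIRST ORDER IN `(d−1)(M−1)M·a`**: `‖farDefect W M η z κ‖ ≤ 2(d−1)(M−1)M·a · Σ_t ‖η (q+t+(M−1)e_κ) κ‖`
(κ-lines in the comb gauge: `‖W₀([q+t, q+t+Me_κ]) − 1‖ ≤ M·|lowPart κ t|₁·a`). [folklore] -/
theorem norm_farDefect_le (hM : 1 ≤ M) (η : Site d → Fin d → Matrix n n ℂ) (z : Site d) (κ : Fin d) :
    ‖farDefect W M η z κ‖
      ≤ 2 * (((d : ℝ) - 1) * ((M : ℝ) - 1) * M * a)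
        * ∑ r' : {j : Fin d // j ≠ κ} → Fin M, ‖η ((M : ℤ) • z + tbase κ r' + ((M : ℤ) - 1) • e κ) κ‖ := by
  rw [farDefect, mul_sum]
  refine (norm_sum_le _ _).trans (sum_le_sum fun r' _ => ?_)
  have hx : (M : ℤ) • z ≤ (M : ℤ) • z + tbase κ r' := le_add_of_nonneg_right (tbase_nonneg κ r')
  have hseg := norm_hol_comb_seg_sub_one_le hW hWa z hx κ M
  rw [add_sub_cancel_left] at hseg
  have hl1 : (l1 (lowPart κ (tbase κ r')) : ℝ) ≤ ((d : ℝ) - 1) * ((M : ℝ) - 1) :=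
    l1_lowPart_le_single κ (tbase_nonneg κ r') (tbase_le hM κ r')
  have hu : hol (gaugeAct (btree M W z) W) ((M : ℤ) • z + tbase κ r') (seg κ M) ∈ unitaryUnits (Matrix n n ℂ) :=
    hol_mem_of (isUnitaryCfg_comb hW M z) _ _
  have hM0 : (0 : ℝ) ≤ M := by positivity
  have h3 : (M : ℝ) * (l1 (lowPart κ (tbase κ r')) * a) ≤ ((d : ℝ) - 1) * ((M : ℝ) - 1) * M * a := by
    have := mul_le_mul_of_nonneg_right hl1 ha
    nlinarith
  calc _ ≤ 2 * ‖((hol (gaugeAct (btree M W z) W) ((M : ℤ) • z + tbase κ r') (seg κ M) : (Matrix n n ℂ)ˣ) : Matrix n n ℂ) - 1‖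
        * ‖Ad (btree M W z ((M : ℤ) • z + tbase κ r' + (M : ℤ) • e κ)) (η ((M : ℤ) • z + tbase κ r' + ((M : ℤ) - 1) • e κ) κ)‖ :=
        norm_Ad_sub_le hu _
    _ ≤ 2 * (((d : ℝ) - 1) * ((M : ℝ) - 1) * M * a) * ‖η ((M : ℤ) • z + tbase κ r' + ((M : ℤ) - 1) • e κ) κ‖ := by
        rw [norm_Ad_of_unitary (btree_mem hW M z _)]
        gcongr
        exact hseg.trans h3

/-- **THE NEAR-FACE DEFECT IS FIRST ORDER IN `(d−1)(M−1)M·a`**: `‖nearDefect W M η z κ‖ ≤ 2(d−1)(M−1)M·a · Σ_t ‖η (q+t−e_κ) κ‖`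
(Bałaban's loop bound `‖Wcx − 1‖ ≤ (d−1)(M−1)M·a`, B8 `norm_Wcx_sub_one_le_omega` BY NAME, through the unitary conjugation of §3).
[folklore] -/
theorem norm_nearDefect_le (hM : 1 ≤ M) (η : Site d → Fin d → Matrix n n ℂ) (z : Site d) (κ : Fin d) :
    ‖nearDefect W M η z κ‖
      ≤ 2 * (((d : ℝ) - 1) * ((M : ℝ) - 1) * M * a)
        * ∑ r' : {j : Fin d // j ≠ κ} → Fin M, ‖η ((M : ℤ) • z + tbase κ r' - e κ) κ‖ := by
  rw [nearDefect, mul_sum]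
  refine (norm_sum_le _ _).trans (sum_le_sum fun r' _ => ?_)
  set t : Site d := tbase κ r' with ht
  set B := btree M W z ((M : ℤ) • z + t) with hB
  set S := bseg M W (z - e κ) κ with hS
  set A₀ := hol W ((M : ℤ) • (z - e κ)) (treeWord t ++ seg κ M) with hA₀
  set Y := η ((M : ℤ) • z + t - e κ) κ with hY
  have hBu : B ∈ unitaryUnits (Matrix n n ℂ) := btree_mem hW M z _
  have hSu : S ∈ unitaryUnits (Matrix n n ℂ) := bseg_mem hW M _ κ
  have hAu : A₀ ∈ unitaryUnits (Matrix n n ℂ) := hol_mem_of hW _ _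
  -- Ad_B Y − Ad_{S⁻¹A₀} Y = Ad_B (Y − Ad_{B⁻¹ S⁻¹ A₀} Y)
  have hgu : B⁻¹ * (S⁻¹ * A₀) ∈ unitaryUnits (Matrix n n ℂ) :=
    Subgroup.mul_mem _ (Subgroup.inv_mem _ hBu) (Subgroup.mul_mem _ (Subgroup.inv_mem _ hSu) hAu)
  have hrew : Ad B Y - Ad (S⁻¹ * A₀) Y = Ad B (Y - Ad (B⁻¹ * (S⁻¹ * A₀)) Y) := by
    rw [Ad_sub, ← Ad_mul, mul_inv_cancel_left]
  rw [hrew, norm_Ad_of_unitary hBu, ← norm_neg, neg_sub]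
  refine (norm_Ad_sub_le hgu Y).trans ?_
  -- the conjugate of Wcx
  have hconj := loop_conj_eq M W z t κ
  rw [← hB, ← hS, ← hA₀] at hconj
  have hSB : S * B ∈ unitaryUnits (Matrix n n ℂ) := Subgroup.mul_mem _ hSu hBu
  have hnorm : ‖((B⁻¹ * (S⁻¹ * A₀) : (Matrix n n ℂ)ˣ) : Matrix n n ℂ) - 1‖
      ≤ ‖((Wcx M W ((M : ℤ) • (z - e κ)) κ t : (Matrix n n ℂ)ˣ) : Matrix n n ℂ) - 1‖ := by
    rw [hconj, Units.val_mul, Units.val_mul]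
    exact norm_units_inv_conj_sub_one_le (mem_U1_of_unitary hSB) _
  -- Bałaban's loop bound on the double block [q′, q′ + pairTop M κ]
  obtain ⟨r, hr⟩ : ∃ r : Fin d → Fin M, t = boxVec M r :=
    ⟨(Equiv.funSplitAt κ (Fin M)).symm (⟨0, hM⟩, r'), by rw [boxVec_funSplitAt_symm]; simp [ht]⟩
  have hloop : ‖((Wcx M W ((M : ℤ) • (z - e κ)) κ t : (Matrix n n ℂ)ˣ) : Matrix n n ℂ) - 1‖ ≤ omegaC d M a := by
    rw [hr]
    exact norm_Wcx_sub_one_le_omega M W (fun x μ => mem_U1_of_unitary (hW x μ))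
      (plaqSmall_of_smallField hWa _ _) ha ((M : ℤ) • (z - e κ)) κ le_rfl le_rfl r
  have hω : omegaC d M a = ((d : ℝ) - 1) * ((M : ℝ) - 1) * M * a := by rw [omegaC]; ring
  rw [hω] at hloop
  gcongr
  exact hnorm.trans hloop

end Bounds

/-! ## §5 Periodicity of the face flux in the block index -/

/-- For `(M·N)`-periodic `W` and `η` the face flux is `N`-periodic in the block index. [folklore] -/
theorem farFlux_add_period {M N : ℕ} {W : Site d → Fin d → (Matrix n n ℂ)ˣ} (hWP : IsPeriodicCfg W ((M * N : ℕ) : ℤ))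
    {η : Site d → Fin d → Matrix n n ℂ} (hη : ∀ (x : Site d) (τ μ : Fin d), η (x + ((M * N : ℕ) : ℤ) • e τ) μ = η x μ)
    (z : Site d) (τ κ : Fin d) : farFlux W M η (z + (N : ℤ) • e τ) κ = farFlux W M η z κ := by
  unfold farFlux
  refine Fintype.sum_congr _ _ fun r' => ?_
  have hq : (M : ℤ) • (z + (N : ℤ) • e τ) = (M : ℤ) • z + ((M * N : ℕ) : ℤ) • e τ := by
    rw [smul_add, smul_smul]; push_cast; ring_nf
  rw [hq, hol_add_period hWP τ]
  congr 1
  rw [show (M : ℤ) • z + ((M * N : ℕ) : ℤ) • e τ + tbase κ r' + ((M : ℤ) - 1) • e κ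
      = ((M : ℤ) • z + tbase κ r' + ((M : ℤ) - 1) • e κ) + ((M * N : ℕ) : ℤ) • e τ by abel, hη]

end

end Summit.QuantumFields.BalabanUV.T4Continuum.NE3CovariantBlockDivergence
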